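import Summits.Ventures.Crystal3D.Theorems.StickyWulffConstantCoaxialWallLawCslGrainLedgerTop
import Summits.Ventures.Crystal3D.Theorems.StickyWulffConstantCoaxialWallLawRigidLedger
import Summits.Ventures.Crystal3D.Theorems.StickyWulffConstantCoaxialWallLawHaggConst
import Summits.Ventures.Crystal3D.Theorems.StickyWulffConstantGenericWallFloorCoaxialIff
import Summits.Ventures.Crystal3D.Theorems.StickyWulffConstantNoReconstructionGainLatticeAdhesion
import HarnessLib

/-!
# The rigid rung of `stub_coaxialTwoSlabAdhesion` for CSL twin pairs (coincidence sites), rim-local form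

HONEST FRAMING. Part of the venture `Summits/Ventures/Crystal3D` (cell `crystal3d-full`), helper
`--supports` the crux `CoaxialWallLaw` (stmt-Ventures-19481, `route-Ventures-StickyWulffConstant`),
REGISTERED line `WallLedgerF` (planner cf-p1 gen 16), stub `stub_coaxialTwoSlabAdhesion`.
RUNG CREDIT ONLY.  Complements `coaxialTwoSlabAdhesion_rigid_twin(_rimLocal)` (grains WITHOUT
coincidence sites) by the case WITH a coincidence site `c ∈ Λ₁ ∩ Λ₂` (Σ3 coincidence-site
lattice: coherent twins with risers, CSL offsets), following the planner's CSL-TWIN memo (cf-p1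
gen 21): in normal form the pair is `(M·Λ₀ + c, M·Λ₀⁻ + c)`, non-coincidence balls have no cross
contacts (absorption at weight ONE), and the coincidence in-plane lines (which run plate to plate)
are at most half of the in-plane lines (`csl_card_tops_le_two_mul_nonCoinc`).

**Theorem (`coaxialTwoSlabAdhesion_rigid_cslTwin_rimLocal`).**  For a co-axial pair with different
linear parts (twin) and a coincidence site, and every RIGID filling `X ⊆ Λ₁ ∪ Λ₂` of the clamped
cylinder cell (`R₀ = 3`, any `h`, `ρ ≥ 3`):

  `cross(P₁, X∖P₁) + cross(P₂, Y) ≤ D(Y) + (φ₁ + φ₂ − (√6/2)·√(1 − ⟪L e₃, e₃⟫²)) πρ² + C ρ + 24·#{x ∈ X : (ρ−2)² < x₀² + x₁²}`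

— `√6/2 = 1.22 ≥ ½`, error rim-local and `h`-free.  (`halfTurn_frame_images`: the frame `R∘L`
presents `(L·Λ₀⁻ + c, L·Λ₀ + c)`, so both grains are instances of the one-grain lemma.)

WHAT THIS IS NOT: the stub (arbitrary fillings; translation pairs need the axis rule); rung F-C1
not moved.
-/

noncomputable section

namespace Summit.Ventures.Crystal3D.Theorems

open Summit.Ventures.Crystal3D Finset
open Literature.MathematicalPhysics.StatisticalMechanics (fccStacking barlowStacking IsHaggSeq
  contactDeficiency)
open scoped InnerProductSpace

/-- The frame `R∘L` (`R` the half-turn about `e₃`) presents `L·Λ₀⁻ + c` as its fcc grain and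
`L·Λ₀ + c` as its twin grain. -/
theorem halfTurn_frame_images
    (L : EuclideanSpace ℝ (Fin 3) ≃ₗᵢ[ℝ] EuclideanSpace ℝ (Fin 3)) (c : EuclideanSpace ℝ (Fin 3)) :
    (fun q => ((ℝ ∙ EuclideanSpace.single (2 : Fin 3) (1 : ℝ)).reflection.trans L) q + c) ''
        fccStacking 1 (Real.sqrt (2 / 3)) =
      (fun q => L q + c) '' barlowStacking 1 (Real.sqrt (2 / 3)) (fun _ : ℤ => (-1 : ℤ)) ∧
    (fun q => ((ℝ ∙ EuclideanSpace.single (2 : Fin 3) (1 : ℝ)).reflection.trans L) q + c) ''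
        barlowStacking 1 (Real.sqrt (2 / 3)) (fun _ : ℤ => (-1 : ℤ)) =
      (fun q => L q + c) '' fccStacking 1 (Real.sqrt (2 / 3)) := by
  set R := (ℝ ∙ EuclideanSpace.single (2 : Fin 3) (1 : ℝ)).reflection with hR
  have htwin : barlowStacking 1 (Real.sqrt (2 / 3)) (fun _ : ℤ => (-1 : ℤ)) =
      R '' fccStacking 1 (Real.sqrt (2 / 3)) := barlowStacking_negConst_eq_halfTurn_image
  constructor
  · rw [htwin, Set.image_image]
    rfl
  · rw [htwin, Set.image_image]
    ext x
    simp only [Set.mem_image, LinearIsometryEquiv.trans_apply]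
    constructor
    · rintro ⟨q, hq, rfl⟩
      exact ⟨q, hq, by rw [hR, Submodule.reflection_reflection]⟩
    · rintro ⟨q, hq, rfl⟩
      exact ⟨q, hq, by rw [hR, Submodule.reflection_reflection]⟩

/-- **The rigid rung of `stub_coaxialTwoSlabAdhesion` for CSL twin pairs, rim-local form.**
See the module docstring. -/
theorem coaxialTwoSlabAdhesion_rigid_cslTwin_rimLocal
    (A₁ : EuclideanSpace ℝ (Fin 3) ≃ₗᵢ[ℝ] EuclideanSpace ℝ (Fin 3)) (t₁ : EuclideanSpace ℝ (Fin 3))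
    (A₂ : EuclideanSpace ℝ (Fin 3) ≃ₗᵢ[ℝ] EuclideanSpace ℝ (Fin 3)) (t₂ : EuclideanSpace ℝ (Fin 3))
    (hcoax : ∃ (L : EuclideanSpace ℝ (Fin 3) ≃ₗᵢ[ℝ] EuclideanSpace ℝ (Fin 3))
        (s₁ s₂ : EuclideanSpace ℝ (Fin 3)) (σ σ' : ℤ → ℤ), IsHaggSeq σ ∧ IsHaggSeq σ' ∧
        (fun p => A₁ p + t₁) '' fccStacking 1 (Real.sqrt (2 / 3)) ⊆
          (fun p => L p + s₁) '' barlowStacking 1 (Real.sqrt (2 / 3)) σ ∧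
        (fun p => A₂ p + t₂) '' fccStacking 1 (Real.sqrt (2 / 3)) ⊆
          (fun p => L p + s₂) '' barlowStacking 1 (Real.sqrt (2 / 3)) σ')
    (htwin : A₁ '' fccStacking 1 (Real.sqrt (2 / 3)) ≠ A₂ '' fccStacking 1 (Real.sqrt (2 / 3)))
    (c : EuclideanSpace ℝ (Fin 3))
    (hc₁ : c ∈ (fun q => A₁ q + t₁) '' fccStacking 1 (Real.sqrt (2 / 3)))
    (hc₂ : c ∈ (fun q => A₂ q + t₂) '' fccStacking 1 (Real.sqrt (2 / 3))) :
    ∃ (L : EuclideanSpace ℝ (Fin 3) ≃ₗᵢ[ℝ] EuclideanSpace ℝ (Fin 3))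
        (s₁ s₂ : EuclideanSpace ℝ (Fin 3)) (σ σ' : ℤ → ℤ), IsHaggSeq σ ∧ IsHaggSeq σ' ∧
        (fun p => A₁ p + t₁) '' fccStacking 1 (Real.sqrt (2 / 3)) ⊆
          (fun p => L p + s₁) '' barlowStacking 1 (Real.sqrt (2 / 3)) σ ∧
        (fun p => A₂ p + t₂) '' fccStacking 1 (Real.sqrt (2 / 3)) ⊆
          (fun p => L p + s₂) '' barlowStacking 1 (Real.sqrt (2 / 3)) σ' ∧
    ∃ C : ℝ, ∀ h : ℝ, ∀ ρ : ℝ, 3 ≤ ρ →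
      ∀ X P₁ P₂ : Finset (EuclideanSpace ℝ (Fin 3)),
      (∀ p ∈ X, ∀ q ∈ X, p ≠ q → 1 ≤ dist p q) → P₁ ⊆ X → P₂ ⊆ X \ P₁ →
      (∀ p ∈ X, -(2 * 3) ≤ p 2 ∧ p 2 ≤ h + 2 * 3 ∧ p 0 ^ 2 + p 1 ^ 2 ≤ ρ ^ 2) →
      (∀ p, p ∈ P₁ ↔ (p ∈ (fun q => A₁ q + t₁) '' fccStacking 1 (Real.sqrt (2 / 3)) ∧
        -(2 * 3) ≤ p 2 ∧ p 2 ≤ -3 ∧ p 0 ^ 2 + p 1 ^ 2 ≤ ρ ^ 2)) →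
      (∀ p, p ∈ P₂ ↔ (p ∈ (fun q => A₂ q + t₂) '' fccStacking 1 (Real.sqrt (2 / 3)) ∧
        h + 3 ≤ p 2 ∧ p 2 ≤ h + 2 * 3 ∧ p 0 ^ 2 + p 1 ^ 2 ≤ ρ ^ 2)) →
      (∀ p ∈ X, p ∈ (fun q => A₁ q + t₁) '' fccStacking 1 (Real.sqrt (2 / 3)) ∨
        p ∈ (fun q => A₂ q + t₂) '' fccStacking 1 (Real.sqrt (2 / 3))) →
      ((((P₁ ×ˢ (X \ P₁)).filter fun pq => dist pq.1 pq.2 = 1).card : ℕ) : ℝ) +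
        ((((P₂ ×ˢ ((X \ P₁) \ P₂)).filter fun pq => dist pq.1 pq.2 = 1).card : ℕ) : ℝ) ≤
        contactDeficiency ((X \ P₁) \ P₂) +
          (Real.sqrt 2 / 4 * ∑ᶠ w ∈ {w ∈ fccStacking 1 (Real.sqrt (2 / 3)) | ‖w‖ = 1},
              |⟪w, A₁.symm (EuclideanSpace.single (2 : Fin 3) (1 : ℝ))⟫_ℝ| +
            Real.sqrt 2 / 4 * ∑ᶠ w ∈ {w ∈ fccStacking 1 (Real.sqrt (2 / 3)) | ‖w‖ = 1},
              |⟪w, A₂.symm (EuclideanSpace.single (2 : Fin 3) (1 : ℝ))⟫_ℝ| -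
            Real.sqrt 6 / 2 * Real.sqrt (1 - ⟪L (EuclideanSpace.single (2 : Fin 3) (1 : ℝ)),
              (EuclideanSpace.single (2 : Fin 3) (1 : ℝ))⟫_ℝ ^ 2)) * Real.pi * ρ ^ 2 +
          C * ρ + 24 * ((X.filter fun x => (ρ - 2) ^ 2 < x 0 ^ 2 + x 1 ^ 2).card : ℝ) := by
  classical
  obtain ⟨L, s₁, s₂, σ, σ', hσ, hσ', hsub₁, hsub₂⟩ := hcoax
  obtain ⟨C₁, hC₁⟩ := affineSampleDeficit_upper A₁ t₁ 3 (by norm_num)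
  obtain ⟨C₂, hC₂⟩ := affineSampleDeficit_upper A₂ t₂ 3 (by norm_num)
  refine ⟨L, s₁, s₂, σ, σ', hσ, hσ', hsub₁, hsub₂, C₁ + C₂ + 135 * Real.sqrt 2 * Real.pi + 360, ?_⟩
  intro h ρ hρ X P₁ P₂ hX hP₁X hP₂X₁ hcyl hP₁ hP₂ hrigid
  set e₃ : EuclideanSpace ℝ (Fin 3) := EuclideanSpace.single (2 : Fin 3) (1 : ℝ) with he₃
  set R : EuclideanSpace ℝ (Fin 3) ≃ₗᵢ[ℝ] EuclideanSpace ℝ (Fin 3) :=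
    (ℝ ∙ EuclideanSpace.single (2 : Fin 3) (1 : ℝ)).reflection with hR
  set φ₁ : ℝ := Real.sqrt 2 / 4 * ∑ᶠ w ∈ {w ∈ fccStacking 1 (Real.sqrt (2 / 3)) | ‖w‖ = 1},
      |⟪w, A₁.symm e₃⟫_ℝ| with hφ₁
  set φ₂ : ℝ := Real.sqrt 2 / 4 * ∑ᶠ w ∈ {w ∈ fccStacking 1 (Real.sqrt (2 / 3)) | ‖w‖ = 1},
      |⟪w, A₂.symm e₃⟫_ℝ| with hφ₂
  set Λ₁ : Set (EuclideanSpace ℝ (Fin 3)) := (fun q => A₁ q + t₁) '' fccStacking 1 (Real.sqrt (2 / 3)) with hΛ₁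
  set Λ₂ : Set (EuclideanSpace ℝ (Fin 3)) := (fun q => A₂ q + t₂) '' fccStacking 1 (Real.sqrt (2 / 3)) with hΛ₂
  have hP₂X : P₂ ⊆ X := hP₂X₁.trans sdiff_subset
  -- the pair is a twin pair in the frame: `σ 0 ≠ σ' 0`
  have htw : σ 0 ≠ σ' 0 := by
    intro heq
    obtain ⟨-, e₁⟩ := linear_image_eq_frame_of_subset A₁ L t₁ s₁ hσ hsub₁
    obtain ⟨-, e₂⟩ := linear_image_eq_frame_of_subset A₂ L t₂ s₂ hσ' hsub₂
    exact htwin (by rw [e₁, e₂, heq])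
  -- normal form: `Λ₁ = M₁·Λ₀ + c = M₂·Λ₀⁻ + c`, `Λ₂ = M₁·Λ₀⁻ + c = M₂·Λ₀ + c`
  have hnorm : ∃ M₁ M₂ : EuclideanSpace ℝ (Fin 3) ≃ₗᵢ[ℝ] EuclideanSpace ℝ (Fin 3),
      Λ₁ = (fun q => M₁ q + c) '' fccStacking 1 (Real.sqrt (2 / 3)) ∧
      Λ₂ = (fun q => M₁ q + c) '' barlowStacking 1 (Real.sqrt (2 / 3)) (fun _ : ℤ => (-1 : ℤ)) ∧
      Λ₂ = (fun q => M₂ q + c) '' fccStacking 1 (Real.sqrt (2 / 3)) ∧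
      Λ₁ = (fun q => M₂ q + c) '' barlowStacking 1 (Real.sqrt (2 / 3)) (fun _ : ℤ => (-1 : ℤ)) ∧
      M₁ e₃ = L e₃ ∧ M₂ e₃ = L e₃ := by
    obtain ⟨hRL₁, hRL₂⟩ := halfTurn_frame_images L c
    have hax : (R.trans L) e₃ = L e₃ := by rw [LinearIsometryEquiv.trans_apply, halfTurn_e₃]
    rcases hσ 0 with h1 | hm1
    · have hm1' : σ' 0 = -1 := (hσ' 0).resolve_left fun h' => htw (h1.trans h'.symm)
      have e₁ := coaxial_frame_eq_fcc_of_one A₁ t₁ L s₁ hσ hsub₁ h1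
      obtain ⟨e₂, -⟩ := coaxial_frame_eq_fcc_of_neg_one A₂ t₂ L s₂ hσ' hsub₂ hm1'
      have hc₁' : c ∈ (fun q => L q + s₁) '' fccStacking 1 (Real.sqrt (2 / 3)) := by
        rw [← e₁]; exact hc₁
      have hc₂' : c ∈ (fun q => (R.trans L) q + s₂) '' fccStacking 1 (Real.sqrt (2 / 3)) := by
        rw [← e₂]; exact hc₂
      obtain ⟨n₁, n₂⟩ := movedTwin_eq_of_common_point L s₁ s₂ c hc₁' hc₂'
      refine ⟨L, R.trans L, ?_, ?_, ?_, ?_, rfl, hax⟩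
      · rw [hΛ₁, e₁, n₁]
      · rw [hΛ₂, e₂, n₂]
      · rw [hΛ₂, e₂, n₂, hRL₁]
      · rw [hΛ₁, e₁, n₁, hRL₂]
    · have h1' : σ' 0 = 1 := (hσ' 0).resolve_right fun h' => htw (hm1.trans h'.symm)
      obtain ⟨e₁, -⟩ := coaxial_frame_eq_fcc_of_neg_one A₁ t₁ L s₁ hσ hsub₁ hm1
      have e₂ := coaxial_frame_eq_fcc_of_one A₂ t₂ L s₂ hσ' hsub₂ h1'
      have hc₂' : c ∈ (fun q => L q + s₂) '' fccStacking 1 (Real.sqrt (2 / 3)) := by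
        rw [← e₂]; exact hc₂
      have hc₁' : c ∈ (fun q => (R.trans L) q + s₁) '' fccStacking 1 (Real.sqrt (2 / 3)) := by
        rw [← e₁]; exact hc₁
      obtain ⟨n₂, n₁⟩ := movedTwin_eq_of_common_point L s₂ s₁ c hc₂' hc₁'
      refine ⟨R.trans L, L, ?_, ?_, ?_, ?_, hax, rfl⟩
      · rw [hΛ₁, e₁, n₁, hRL₁]
      · rw [hΛ₂, e₂, n₂, hRL₂]
      · rw [hΛ₂, e₂, n₂]
      · rw [hΛ₁, e₁, n₁]
  obtain ⟨M₁, M₂, e₁₁, e₁₂, e₂₂, e₂₁, ax₁, ax₂⟩ := hnorm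
  -- (1) the two slab samples from above (original presentation)
  have hD₁ := hC₁ (-(2 * 3)) (-3) (by norm_num) ρ hρ P₁ hP₁
  have hD₂ := hC₂ (h + 3) (h + 2 * 3) (by ring) ρ hρ P₂ hP₂
  -- (2) the two CSL grain lemmas
  have hP₁' : ∀ p, p ∈ P₁ ↔ (p ∈ (fun q => M₁ q + c) '' fccStacking 1 (Real.sqrt (2 / 3)) ∧
      -(2 * 3) ≤ p 2 ∧ p 2 ≤ -3 ∧ p 0 ^ 2 + p 1 ^ 2 ≤ ρ ^ 2) := by
    intro p; rw [hP₁ p, e₁₁]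
  have hP₂' : ∀ p, p ∈ P₂ ↔ (p ∈ (fun q => M₂ q + c) '' fccStacking 1 (Real.sqrt (2 / 3)) ∧
      h + 3 ≤ p 2 ∧ p 2 ≤ h + 2 * 3 ∧ p 0 ^ 2 + p 1 ^ 2 ≤ ρ ^ 2) := by
    intro p; rw [hP₂ p, e₂₂]
  have hrig₁ : ∀ p ∈ X, p ∈ (fun q => M₁ q + c) '' fccStacking 1 (Real.sqrt (2 / 3)) ∨
      p ∈ (fun q => M₁ q + c) '' barlowStacking 1 (Real.sqrt (2 / 3)) (fun _ : ℤ => (-1 : ℤ)) := by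
    intro p hp; rw [← e₁₁, ← e₁₂]; exact hrigid p hp
  have hrig₂ : ∀ p ∈ X, p ∈ (fun q => M₂ q + c) '' fccStacking 1 (Real.sqrt (2 / 3)) ∨
      p ∈ (fun q => M₂ q + c) '' barlowStacking 1 (Real.sqrt (2 / 3)) (fun _ : ℤ => (-1 : ℤ)) := by
    intro p hp; rw [← e₂₂, ← e₂₁]; exact (hrigid p hp).symm
  have g₁ := csl_grain_ledger M₁ c X P₁ 3 h ρ le_rfl hρ hX hcyl hP₁X hP₁' hrig₁
  have g₂ := csl_grain_ledger_top M₂ c X P₂ 3 h ρ le_rfl hρ hX hcyl hP₂X hP₂' hrig₂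
  rw [← e₁₁, ← e₁₂] at g₁
  rw [← e₂₂, ← e₂₁] at g₂
  -- face fluxes and sines in the crux's terms
  have hf₁ : Real.sqrt 2 / 4 * ∑ w ∈ fccSlots, |⟪M₁ w, e₃⟫_ℝ| = φ₁ := by
    rw [hφ₁, finsum_unit_fcc_symm_eq_sum_slots, sum_abs_inner_slots_eq_of_movedFcc_eq A₁ M₁ t₁ c e₁₁]
  have hf₂ : Real.sqrt 2 / 4 * ∑ w ∈ fccSlots, |⟪M₂ w, e₃⟫_ℝ| = φ₂ := by
    rw [hφ₂, finsum_unit_fcc_symm_eq_sum_slots, sum_abs_inner_slots_eq_of_movedFcc_eq A₂ M₂ t₂ c e₂₂]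
  rw [hf₁, ax₁] at g₁
  rw [hf₂, ax₂] at g₂
  -- (3) the two partial ledgers are disjoint parts of `2 D(X) = Σ_x (12 − deg x)`
  set S₁ := X.filter (fun x => x ∈ Λ₁ ∧ (x ∉ Λ₂ ∨ x ∈ P₁)) with hS₁
  set S₂ := X.filter (fun x => x ∈ Λ₂ ∧ (x ∉ Λ₁ ∨ x ∈ P₂)) with hS₂
  have hdj : Disjoint S₁ S₂ := by
    rw [hS₁, hS₂, disjoint_filter]
    rintro p - ⟨hp1, hor1⟩ ⟨hp2, hor2⟩
    have hpP₁ : p ∈ P₁ := hor1.resolve_left (not_not.2 hp2)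
    have hpP₂ : p ∈ P₂ := hor2.resolve_left (not_not.2 hp1)
    exact (mem_sdiff.1 (hP₂X₁ hpP₂)).2 hpP₁
  have hsum_le : ∑ x ∈ S₁, ((12 : ℝ) - ((X.filter fun q => dist x q = 1).card : ℝ)) +
      ∑ x ∈ S₂, ((12 : ℝ) - ((X.filter fun q => dist x q = 1).card : ℝ)) ≤
      ∑ x ∈ X, ((12 : ℝ) - ((X.filter fun q => dist x q = 1).card : ℝ)) := by
    rw [← sum_union hdj]
    refine sum_le_sum_of_subset_of_nonneg (union_subset (filter_subset _ _) (filter_subset _ _)) ?_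
    intro x _ _
    have : ((X.filter fun q => dist x q = 1).card : ℝ) ≤ 12 := by
      exact_mod_cast card_filter_dist_eq_one_le_twelve X hX x
    linarith
  have hD := two_mul_contactDeficiency_eq_sum X
  -- rims of the samples are rims of `X`
  have hrim₁ : ((P₁.filter fun x => (ρ - 2) ^ 2 < x 0 ^ 2 + x 1 ^ 2).card : ℝ) ≤
      ((X.filter fun x => (ρ - 2) ^ 2 < x 0 ^ 2 + x 1 ^ 2).card : ℝ) := by
    exact_mod_cast card_le_card (filter_subset_filter _ hP₁X)
  have hrim₂ : ((P₂.filter fun x => (ρ - 2) ^ 2 < x 0 ^ 2 + x 1 ^ 2).card : ℝ) ≤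
      ((X.filter fun x => (ρ - 2) ^ 2 < x 0 ^ 2 + x 1 ^ 2).card : ℝ) := by
    exact_mod_cast card_le_card (filter_subset_filter _ hP₂X)
  -- (4) the two splits of the skeleton
  have hs₁ := contactDeficiency_sdiff_split hP₁X
  have hs₂ := contactDeficiency_sdiff_split hP₂X₁
  -- (5) assemble
  have hρ1 : (0 : ℝ) ≤ ρ - 1 := by linarith
  have h72 : (72 : ℝ) * (3 + 2) * (ρ - 1) ≤ 360 * ρ := by nlinarith
  have hC : (C₁ + C₂ + 135 * Real.sqrt 2 * Real.pi + 360) * ρ =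
      C₁ * ρ + C₂ * ρ + 135 * Real.sqrt 2 * Real.pi * ρ + 360 * ρ := by ring
  rw [hC]
  linarith [g₁, g₂, hsum_le, hD, hD₁, hD₂, hs₁, hs₂, hrim₁, hrim₂, h72]

end Summit.Ventures.Crystal3D.Theorems

end
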